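import Summits.AtomisticToContinuum.HydrodynamicLimit.Theorems.OneFlightGossipEngineClampedTransferDockOfInputs
import Summits.AtomisticToContinuum.HydrodynamicLimit.Theorems.OneFlightGossipEngineClampedTransferDockSeet
import HarnessLib

/-!
# The dock `ClampedTransferDock` modulo the catalogued Gaussian-moment hypothesis (line `Sketch`, crux stmt-AtomisticToContinuum-17615)

Support file (`--supports stmt-AtomisticToContinuum-17615`; registered sub-goal `clampedTransferDock_of_highMomentumCutoff`). One line over two
landed files: `ClampedTransferDockSeet.seet_of_highMomentumCutoff` (the catalogued open hypothesis
`Literature.Barriers.AtomisticToContinuum.HighMomentumCutoff σ`, all `σ < 1/2`, implies SEET) and the line's conditional closing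
`ClampedTransferDockSketch.clampedTransferDock_of_inputs` (p140743). So the dock follows from the Nachtergaele–Yau-type Gaussian velocity
moment along the true evolution, the reference-law band exponential moment `BandCoherenceLDFamily`, and the two transfer-clamp inputs
(iii) `LocalClampedTransferWindowLDFamily`, (iv) `CollisionEnergyActivityTails`; the dock's own binder ECT is then idle
(`ClampedTransferDockSeet.seet_imp_energyCurrentTails`). [cite: NachtergaeleYau2003, §2.3 Assumption II.1]
-/

namespace Summit.AtomisticToContinuum.HydrodynamicLimit.Theorems.ClampedTransferDockSeet

/-! ## The corollary -/

/-- **The dock from the Gaussian-moment hypothesis, the band exponential moment, (iii) and (iv)** (registered sub-goal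
`clampedTransferDock_of_highMomentumCutoff` of line `Sketch`): `seet_of_highMomentumCutoff` composed with the landed conditional
closing `ClampedTransferDockSketch.clampedTransferDock_of_inputs` (p140743). The dock's own binder ECT is then idle
(`seet_imp_energyCurrentTails`). [cite: NachtergaeleYau2003, §2.3 Assumption II.1] -/
theorem clampedTransferDock_of_highMomentumCutoff : (∀ σ : ℝ, 0 < σ → σ < 1 / 2 → Literature.Barriers.AtomisticToContinuum.HighMomentumCutoff σ) → Summit.AtomisticToContinuum.HydrodynamicLimit.Theorems.ClampedTransferDockCubicRate.BandCoherenceLDFamily → Summit.AtomisticToContinuum.HydrodynamicLimit.Theorems.HydroLimitInBandOfHeart.LocalClampedTransferWindowLDFamily → Summit.AtomisticToContinuum.HydrodynamicLimit.Theorems.HydroLimitInBandOfHeart.CollisionEnergyActivityTails → Summit.AtomisticToContinuum.HydrodynamicLimit.Theses.OneFlightGossipEngine.ClampedTransferDock :=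
  fun h hB h₃ h₄ => ClampedTransferDockSketch.clampedTransferDock_of_inputs (seet_of_highMomentumCutoff h) hB h₃ h₄

end Summit.AtomisticToContinuum.HydrodynamicLimit.Theorems.ClampedTransferDockSeet
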